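/-
Copyright (c) 2026. All rights reserved.
Released under Apache 2.0 license as described in the file LICENSE.
-/
import Literature.Geometry.Kaehler.ComplexTorusQuaternionAutomorphismsComplexStructure
import Literature.Geometry.Kaehler.ComplexTorusQuaternionTranscendentalLatticeCM
import HarnessLib

/-!
# `Aut(A(τ), ι)` on `H²(A(τ))`: trivial on the Néron–Severi group `NS(A(τ))`, through the sign character on the
# transcendental lattice `T_{A(τ)}` — the order-`4` automorphisms `±J_τ` of the `Z(1)`-members act on `T_{A(τ)}` by `−1`
# (Shioda–Mitani §1; Kudla–Rapoport–Yang 2006 §3.4; Lange 2023 §7.2; Besser–Livne 2013 §5.2)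

[tag: complex_torus] [tag: abelian_surface] [tag: quaternion_multiplication] [tag: automorphism_group]
[tag: neron_severi] [tag: transcendental_lattice] [tag: shimura_curve] [tag: special_cycles]

Lane `lit-hodgefound`, seat p12, row g27-#8 — the integral representation of `Aut(A(τ), ι)` on
`H²(A(τ), ℤ) ⊇ NS(A(τ)) ⊕ T_{A(τ)}`, assembled from g27-#5 (`…QuaternionAutomorphismsHodgeCircle`: units preserve
every `(1,1)`-form, `apply_map_coe_mulVec_of_isUnit`), g27-#6 (`…QuaternionAutomorphismsComplexStructure`:
`Aut(A(τ), ι) = End ∩ {±1, ±J_τ}`, `map_coe_eq_or_of_isUnit`, `natCard_units_eq_four_iff_exists_map_eq_jMatrix`,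
`natCard_units_eq_four_iff_exists_ofCoords_eq_eta`) and g25-#3 (`…QuaternionTranscendentalLatticeCM`:
`T_{A(τ)} = G(𝒟⁻¹ ∩ U_τ)` at Picard number `4`, `mem_transcendentalLattice_period_iff_of_finrank_eq_four`; the right forms
`G_γ` with `γη_τ = −η_τγ` are of type `(2,0)+(0,2)`, `rightTwoFormR_I_smul_eq_neg_iff`). The complex structure
`J_τ` acts on the universal cover as multiplication by `i` (`ρ(J_τ) = i·1`), so it fixes the `(1,1)`-forms and negates
the real `(2,0)+(2,0)̄`-forms `ψ(iu, iv) = −ψ(u, v)`; an integral `J_τ` (a `Z(1)`-point) forces Picard number `4`, and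
there `T_{A(τ)}` consists of such forms. Nothing restated; tree results used BY NAME.

## The print, VERBATIM

T. Shioda, N. Mitani (1974) [ShiodaMitani1974] §1: «the lattice `T_A` of transcendental cycles on `A` is … the
orthogonal complement of the Néron–Severi group in `H²(A, ℤ)`», (1.5)–(1.6) (`T_X ⊗ ℝ ⊇ (H^{2,0} ⊕ H^{0,2})_ℝ`,
with equality at `ρ = 4`). S. Kudla, M. Rapoport, T. Yang (2006) [KudlaRapoportYang2006] §3.4 p. 52: «the negative
`2`-plane `U(w)`», (3.4.7) «`x̃ = r(j_x)`», «`j_x² = −t`»; §3.2 p. 48 «the automorphisms of `(A_z, ι_z)` are given by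
elements in `Γ_z`». H. Lange (2023) [Lange2023AbelianVarietiesComplex] §7.1.1 Prop. 7.1.1 («`J = h(i)`»), §7.2.2
Thm. 7.2.4 Step I (the weights `z^p z̄^q` of `h(z)` on `H^{p,q}`). A. Besser, R. Livne (2013) [BesserLivne2013]
§5.2 («the transcendental lattice is the image under the first embedding»).

## What is proved (theorems only; no definition, no named fact, no instance)

* §1 GENERAL (namespace `…ComplexTorus`, any torus `X = E/Φ(ℤ^ι)`, real `2`-forms `ψ`):
  `compContinuousLinearMap_analyticRepReal_iff_forall` (bridge: `ψ ∘ ρ(B) = ψ'` iff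
  `ψ(Φ(Bx), Φ(By)) = ψ'(Φx, Φy)` on lattice coordinates), **`compContinuousLinearMap_analyticRepReal_jMatrix_of_oneOne`**
  (`J^*ψ = ψ` for `ψ(iu, iv) = ψ(u, v)`), **`compContinuousLinearMap_analyticRepReal_jMatrix_of_antiOneOne`**
  (`J^*ψ = −ψ` for `ψ(iu, iv) = −ψ(u, v)`, the real `(2,0)+(0,2)`-forms), `…_neg_jMatrix_of_antiOneOne` (`(−J)^*ψ = −ψ`),
  `compContinuousLinearMap_analyticRepReal_neg_one` (`(−1)^*ψ = ψ`), `ofRealForm_compContinuousLinearMap_eq_neg`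
  (complexification).
* §2 FAMILY (namespace `…QuaternionType`): **`finrank_neronSeveriGroup_eq_four_of_exists_map_eq_jMatrix`** (an
  integral `J_τ` forces `ρ(A(τ)) = 4`: the `Z(1)`-points are CM points), **`compContinuousLinearMap_analyticRepReal_eq_self_of_mem_neronSeveriGroup`**
  (every unit of `End(A(τ), ι)` fixes `NS(A(τ))` pointwise), **`compContinuousLinearMap_analyticRepReal_eq_neg_of_mem_transcendentalLattice`**
  (an integral `M` with `M_ℝ = ±J_τ` acts on `T_{A(τ)}` by `−1`), `compContinuousLinearMap_analyticRepReal_eq_self_of_mem_transcendentalLattice`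
  (`±1` act trivially on `T_{A(τ)}`), **`compContinuousLinearMap_analyticRepReal_transcendental_of_isUnit`** (the
  dichotomy: every unit acts on `T_{A(τ)}` by `+1` or `−1`, `−1` exactly for `ρ_r(u) = ±J_τ`),
  `exists_forall_transcendental_eq_neg_of_natCard_eq_four` (at a `Z(1)`-point some automorphism negates `T_{A(τ)}`).
* §3 validation `(−1,3)`, `τ = i`: `compContinuousLinearMap_analyticRepReal_rmulInt_I_of_mem_transcendentalLattice`
  (`R_i` acts on `T_{A(i)}` by `−1`) (the Picard number `4` of `A(i)` is the tree's `finrank_neronSeveriGroup_neg_one_three_I'`,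
  not restated).

## Honest scope

Forms on the universal cover with the pull-back `ψ ↦ ψ ∘ ρ(u)` (`analyticRepReal`); `NS(A(τ))` = the tree's
`neronSeveriGroup` (integral `(1,1)` real `2`-forms), `T_{A(τ)}` = the tree's `transcendentalLattice` (integral complex
`2`-forms wedge-orthogonal to the integral Hodge classes); the `T`-statement needs `M_ℝ = ±J_τ` (so Picard number `4`);
no statement on `H²(A(τ), ℤ)/(NS ⊕ T)`. Everything is proved; 0 definitions, 0 named facts, 0 instances.

## References
* [ShiodaMitani1974] T. Shioda, N. Mitani, Singular abelian surfaces and binary quadratic forms, LNM 412 (1974), §1.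
* [KudlaRapoportYang2006] S. Kudla, M. Rapoport, T. Yang, Modular Forms and Special Cycles on Shimura Curves (2006),
  §3.2 Prop. 3.2.1 p. 48, §3.4 (3.4.7) pp. 52–53.
* [Lange2023AbelianVarietiesComplex] H. Lange, Abelian Varieties over the Complex Numbers (2023), §7.1.1 Prop. 7.1.1,
  §7.2.2 Thm. 7.2.4.
* [BesserLivne2013] A. Besser, R. Livne, Picard groups of the moduli spaces of quaternionic multiplication (2013), §5.2.
-/

noncomputable section

open Complex Module Matrix Quaternion Function
open scoped Manifold ContDiff Real

namespace Literature.Geometry.Kaehler.ComplexTorus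

/-! ## §1 General: `J^*` fixes the `(1,1)`-forms and negates the real `(2,0)+(0,2)`-forms -/

section General

variable {ι : Type*} [Fintype ι] [DecidableEq ι] {E : Type*} [NormedAddCommGroup E] [NormedSpace ℂ E]
  (Φ : (ι → ℝ) ≃L[ℝ] E)

/-- A function `Fin 2 → α` is the pair of its values. [folklore] -/
private theorem eq_vecCons {α : Type*} (v : Fin 2 → α) : v = ![v 0, v 1] := by
  ext i; fin_cases i <;> rfl

omit [DecidableEq ι] in
/-- **Bridge**: `ψ ∘ ρ(B) = ψ'` iff `ψ(Φ(Bx), Φ(By)) = ψ'(Φx, Φy)` for all lattice coordinates `x, y` (`ρ(B) = Φ ∘ B ∘ Φ⁻¹`,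
the tree's `analyticRepReal_apply'`). [cite: Lange2023AbelianVarietiesComplex, §1.1.2 Prop. 1.1.9 (the extension `ρ_r ⊗ 1`)] -/
theorem compContinuousLinearMap_analyticRepReal_iff_forall (B : Matrix ι ι ℝ) (ψ ψ' : E [⋀^Fin 2]→L[ℝ] ℝ) :
    ψ.compContinuousLinearMap (analyticRepReal Φ Φ B) = ψ' ↔
      ∀ x y : ι → ℝ, ψ ![Φ (B *ᵥ x), Φ (B *ᵥ y)] = ψ' ![Φ x, Φ y] := by
  constructor
  · intro h x y
    have hv := congrArg (fun χ : E [⋀^Fin 2]→L[ℝ] ℝ ↦ χ ![Φ x, Φ y]) h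
    simp only [ContinuousAlternatingMap.compContinuousLinearMap_apply] at hv
    rw [← hv]
    congr 1
    ext i
    fin_cases i <;> simp [analyticRepReal_apply']
  · intro h
    ext v
    rw [ContinuousAlternatingMap.compContinuousLinearMap_apply, eq_vecCons (analyticRepReal Φ Φ B ∘ v), eq_vecCons v]
    have h' := h (Φ.symm (v 0)) (Φ.symm (v 1))
    rw [ContinuousLinearEquiv.apply_symm_apply, ContinuousLinearEquiv.apply_symm_apply] at h'
    simpa [analyticRepReal_apply'] using h'

/-- **`J^*ψ = ψ` for a real form of type `(1,1)`** (`ρ(J) = i·1_E`). [cite: Lange2023AbelianVarietiesComplex, §7.1.1 Prop. 7.1.1 («`J = h(i)`») and §7.2.1 Prop. 7.2.3 (proof)] -/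
theorem compContinuousLinearMap_analyticRepReal_jMatrix_of_oneOne {ψ : E [⋀^Fin 2]→L[ℝ] ℝ}
    (h₁₁ : ∀ u v : E, ψ ![I • u, I • v] = ψ ![u, v]) :
    ψ.compContinuousLinearMap (analyticRepReal Φ Φ (jMatrix Φ)) = ψ := by
  rw [compContinuousLinearMap_analyticRepReal_iff_forall]
  intro x y
  rw [jMatrix_mulVec, jMatrix_mulVec, apply_latticeJ, apply_latticeJ, h₁₁]

/-- **`J^*ψ = −ψ` for a real form with `ψ(iu, iv) = −ψ(u, v)`** — the real `(2,0) ⊕ (0,2)`-forms (weights `z²`, `z̄²`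
at `z = i`). [cite: Lange2023AbelianVarietiesComplex, §7.2.2 Thm. 7.2.4 (proof, Step I)] [cite: ShiodaMitani1974, §1 (1.5)] -/
theorem compContinuousLinearMap_analyticRepReal_jMatrix_of_antiOneOne {ψ : E [⋀^Fin 2]→L[ℝ] ℝ}
    (hψ : ∀ u v : E, ψ ![I • u, I • v] = -ψ ![u, v]) :
    ψ.compContinuousLinearMap (analyticRepReal Φ Φ (jMatrix Φ)) = -ψ := by
  rw [compContinuousLinearMap_analyticRepReal_iff_forall]
  intro x y
  rw [jMatrix_mulVec, jMatrix_mulVec, apply_latticeJ, apply_latticeJ, hψ, ContinuousAlternatingMap.neg_apply]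

/-- **`(−J)^*ψ = −ψ` as well** (`ψ(−iu, −iv) = ψ(iu, iv)` by bilinearity). [cite: Lange2023AbelianVarietiesComplex, §7.2.2 Thm. 7.2.4 (proof, Step I)] -/
theorem compContinuousLinearMap_analyticRepReal_neg_jMatrix_of_antiOneOne {ψ : E [⋀^Fin 2]→L[ℝ] ℝ}
    (hψ : ∀ u v : E, ψ ![I • u, I • v] = -ψ ![u, v]) :
    ψ.compContinuousLinearMap (analyticRepReal Φ Φ (-jMatrix Φ)) = -ψ := by
  rw [compContinuousLinearMap_analyticRepReal_iff_forall]
  intro x y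
  rw [Matrix.neg_mulVec, Matrix.neg_mulVec, map_neg, map_neg, jMatrix_mulVec, jMatrix_mulVec, apply_latticeJ,
    apply_latticeJ, show -(I • Φ x) = (-1 : ℝ) • (I • Φ x) by rw [neg_one_smul],
    show -(I • Φ y) = (-1 : ℝ) • (I • Φ y) by rw [neg_one_smul], twoForm_smul_left, twoForm_smul_right, hψ,
    ContinuousAlternatingMap.neg_apply]
  ring

/-- **`(−1)^*ψ = ψ`** for every real `2`-form (`ψ(−u, −v) = ψ(u, v)`). [cite: Lange2023AbelianVarietiesComplex, §7.1.1 («`h(−1) = −1_V`»)] -/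
theorem compContinuousLinearMap_analyticRepReal_neg_one (ψ : E [⋀^Fin 2]→L[ℝ] ℝ) :
    ψ.compContinuousLinearMap (analyticRepReal Φ Φ (-1)) = ψ := by
  rw [compContinuousLinearMap_analyticRepReal_iff_forall]
  intro x y
  rw [Matrix.neg_mulVec, Matrix.neg_mulVec, Matrix.one_mulVec, Matrix.one_mulVec, map_neg, map_neg,
    show -Φ x = (-1 : ℝ) • Φ x by rw [neg_one_smul], show -Φ y = (-1 : ℝ) • Φ y by rw [neg_one_smul],
    twoForm_smul_left, twoForm_smul_right]
  ring

omit [Fintype ι] [DecidableEq ι] in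
/-- Complexification of `f^*ψ = −ψ`: `f^*ψ_ℂ = −ψ_ℂ`. [cite: Lange2023AbelianVarietiesComplex, §1.1.3 Cor. 1.1.19] -/
theorem ofRealForm_compContinuousLinearMap_eq_neg {f : E →L[ℝ] E} {ψ : E [⋀^Fin 2]→L[ℝ] ℝ}
    (h : ψ.compContinuousLinearMap f = -ψ) : (ofRealForm ψ).compContinuousLinearMap f = -ofRealForm ψ := by
  ext v
  have hv := congrArg (fun χ : E [⋀^Fin 2]→L[ℝ] ℝ ↦ ((χ v : ℝ) : ℂ)) h
  simpa [ofRealForm_apply] using hv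

omit [Fintype ι] [DecidableEq ι] in
/-- Complexification of `f^*ψ = ψ`: `f^*ψ_ℂ = ψ_ℂ`. [cite: Lange2023AbelianVarietiesComplex, §1.1.3 Cor. 1.1.19] -/
theorem ofRealForm_compContinuousLinearMap_eq_self {f : E →L[ℝ] E} {ψ : E [⋀^Fin 2]→L[ℝ] ℝ}
    (h : ψ.compContinuousLinearMap f = ψ) : (ofRealForm ψ).compContinuousLinearMap f = ofRealForm ψ := by
  ext v
  have hv := congrArg (fun χ : E [⋀^Fin 2]→L[ℝ] ℝ ↦ ((χ v : ℝ) : ℂ)) h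
  simpa [ofRealForm_apply] using hv

end General

/-! ## §2 Lang's quaternionic family: `Aut(A(τ), ι)` is trivial on `NS(A(τ))` and acts on `T_{A(τ)}` through `{±1}` -/

namespace QuaternionType

section Family

variable {a b : ℤ} {τ : ℂ} (ha : a ≠ 0) (hb : 0 < b) (hτ : τ.im ≠ 0)

/-- Entrywise cast of `−A`. [folklore] -/
private theorem map_intCast_neg_aux (A : Matrix (Fin 4) (Fin 4) ℤ) :
    (-A).map (Int.cast : ℤ → ℝ) = -A.map (Int.cast : ℤ → ℝ) :=
  Matrix.map_neg _ (fun x ↦ Int.cast_neg x) A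

/-- **An integral complex structure forces Picard number `4`**: if `J_τ = R_{η_τ}` is an integral matrix (equivalently
`w(A(τ), ι) = 4`, g27-#6) then `η_τ ∈ 𝔬` is a non-zero pure element of `Q` commuting with `η_τ`, so `ρ(A(τ)) = 4`
(the `Z(1)`-points are CM points). [cite: KudlaRapoportYang2006, §3.4 (3.4.7)–(3.4.9) («`D_t = ∐_{x ∈ L(t)} D_x`»)] [cite: ShiodaMitani1974, §4 Thm. 4.1] -/
theorem finrank_neronSeveriGroup_eq_four_of_exists_map_eq_jMatrix
    (h : ∃ A : Matrix (Fin 4) (Fin 4) ℤ, A.map (Int.cast : ℤ → ℝ) = jMatrix (period a b ha hb hτ)) :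
    finrank ℤ (neronSeveriGroup (period a b ha hb hτ)) = 4 := by
  obtain ⟨n, hn⟩ := (natCard_units_eq_four_iff_exists_ofCoords_eq_eta ha hb hτ).1
    ((natCard_units_eq_four_iff_exists_map_eq_jMatrix ha hb hτ).2 h)
  refine (finrank_neronSeveriGroup_eq_four_iff_exists_comm_eta ha hb hτ).2
    ⟨ofCoords a b fun k ↦ ((n k : ℤ) : ℚ), ?_, ?_, ?_⟩
  · have h0 := congrArg QuaternionAlgebra.re hn
    rw [ofCoords_re, eta_re] at h0
    have h0' : n 0 = 0 := by exact_mod_cast h0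
    rw [ofCoords_re, h0', Int.cast_zero]
  · intro h0
    have h1 := congrArg (castQ a b) h0
    rw [castQ_ofCoords_intCast, hn, castQ_zero] at h1
    have h2 := eta_mul_eta ha hb hτ
    rw [h1, mul_zero] at h2
    exact one_ne_zero (neg_eq_zero.1 h2.symm)
  · rw [castQ_ofCoords_intCast, hn]

/-- `M_ℝ = ±J_τ ⟹ ρ(A(τ)) = 4`. [cite: KudlaRapoportYang2006, §3.4 (3.4.7)–(3.4.9)] [cite: ShiodaMitani1974, §4 Thm. 4.1] -/
theorem finrank_neronSeveriGroup_eq_four_of_map_eq {M : Matrix (Fin 4) (Fin 4) ℤ}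
    (hJ : M.map (Int.cast : ℤ → ℝ) = jMatrix (period a b ha hb hτ) ∨
      M.map (Int.cast : ℤ → ℝ) = -jMatrix (period a b ha hb hτ)) :
    finrank ℤ (neronSeveriGroup (period a b ha hb hτ)) = 4 := by
  refine finrank_neronSeveriGroup_eq_four_of_exists_map_eq_jMatrix ha hb hτ ?_
  rcases hJ with h | h
  · exact ⟨M, h⟩
  · exact ⟨-M, by rw [map_intCast_neg_aux, h, neg_neg]⟩

/-- **`Aut(A(τ), ι)` fixes `NS(A(τ))` pointwise**: `u^*η = η` for every unit `u` of `End(A(τ), ι)` and every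
`η ∈ NS(A(τ))` (integral `(1,1)`-forms; g27-#5). [cite: KudlaRapoportYang2006, §3.1 p. 46 and §3.2 Prop. 3.2.1 (proof) p. 48] [cite: Lange2023AbelianVarietiesComplex, §7.2.1 Prop. 7.2.3] -/
theorem compContinuousLinearMap_analyticRepReal_eq_self_of_mem_neronSeveriGroup {M : equivariantEndRingInt ha hb hτ}
    (hM : IsUnit M) {η : (Fin 2 → ℂ) [⋀^Fin 2]→L[ℝ] ℝ} (hη : η ∈ neronSeveriGroup (period a b ha hb hτ)) :
    η.compContinuousLinearMap (analyticRepReal (period a b ha hb hτ) (period a b ha hb hτ)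
      ((M : Matrix (Fin 4) (Fin 4) ℤ).map (Int.cast : ℤ → ℝ))) = η :=
  (compContinuousLinearMap_analyticRepReal_iff_forall _ _ _ _).2
    (apply_map_coe_mulVec_of_isUnit ha hb hτ hM ((mem_neronSeveriGroup_iff _).1 hη).1)

/-- **The order-`4` automorphisms act on the transcendental lattice by `−1`**: for an integral `M` with
`M_ℝ = ±J_τ` and every `t ∈ T_{A(τ)}`, `M^*t = −t` (`ρ(A(τ)) = 4`, so `t = [G_γ]` with `γη_τ = −η_τγ`, a real
`(2,0)+(0,2)`-form, on which `J_τ` acts by `i² = −1`). [cite: ShiodaMitani1974, §1 (1.5)–(1.6)] [cite: KudlaRapoportYang2006, §3.4 p. 52 («the negative `2`-plane `U(w)`») and (3.4.7)] [cite: Lange2023AbelianVarietiesComplex, §7.2.2 Thm. 7.2.4 (proof, Step I)] [cite: BesserLivne2013, §5.2] -/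
theorem compContinuousLinearMap_analyticRepReal_eq_neg_of_mem_transcendentalLattice {M : Matrix (Fin 4) (Fin 4) ℤ}
    (hJ : M.map (Int.cast : ℤ → ℝ) = jMatrix (period a b ha hb hτ) ∨
      M.map (Int.cast : ℤ → ℝ) = -jMatrix (period a b ha hb hτ))
    {t : (Fin 2 → ℂ) [⋀^Fin 2]→L[ℝ] ℂ} (ht : t ∈ transcendentalLattice (period a b ha hb hτ)) :
    t.compContinuousLinearMap (analyticRepReal (period a b ha hb hτ) (period a b ha hb hτ)
      (M.map (Int.cast : ℤ → ℝ))) = -t := by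
  have h4 := finrank_neronSeveriGroup_eq_four_of_map_eq ha hb hτ hJ
  obtain ⟨γ, -, hγ, hU, rfl⟩ := (mem_transcendentalLattice_period_iff_of_finrank_eq_four ha hb hτ h4).1 ht
  have hanti : ∀ u v : Fin 2 → ℂ, rightTwoForm ha hb hτ γ hγ ![I • u, I • v] = -rightTwoForm ha hb hτ γ hγ ![u, v] := by
    rw [rightTwoForm_eq_rightTwoFormR]
    exact (rightTwoFormR_I_smul_eq_neg_iff ha hb hτ _).2 hU
  refine ofRealForm_compContinuousLinearMap_eq_neg ?_
  rcases hJ with h | h <;> rw [h]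
  · exact compContinuousLinearMap_analyticRepReal_jMatrix_of_antiOneOne _ hanti
  · exact compContinuousLinearMap_analyticRepReal_neg_jMatrix_of_antiOneOne _ hanti

/-- **`±1` act trivially on `T_{A(τ)}`** (indeed on every `2`-form: `ψ(−u, −v) = ψ(u, v)`; a transcendental class is
`[G_γ]`, `exists_eq_rightTwoForm_of_mem_transcendentalLattice`). [cite: ShiodaMitani1974, §1] [cite: BesserLivne2013, §5.2] -/
theorem compContinuousLinearMap_analyticRepReal_eq_self_of_mem_transcendentalLattice {M : Matrix (Fin 4) (Fin 4) ℤ}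
    (h1 : M.map (Int.cast : ℤ → ℝ) = 1 ∨ M.map (Int.cast : ℤ → ℝ) = -1)
    {t : (Fin 2 → ℂ) [⋀^Fin 2]→L[ℝ] ℂ} (ht : t ∈ transcendentalLattice (period a b ha hb hτ)) :
    t.compContinuousLinearMap (analyticRepReal (period a b ha hb hτ) (period a b ha hb hτ)
      (M.map (Int.cast : ℤ → ℝ))) = t := by
  obtain ⟨γ, -, hγ, rfl⟩ := exists_eq_rightTwoForm_of_mem_transcendentalLattice ha hb hτ ht
  refine ofRealForm_compContinuousLinearMap_eq_self ?_
  rcases h1 with h | h <;> rw [h]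
  · rw [analyticRepReal_one]
    ext v
    rfl
  · exact compContinuousLinearMap_analyticRepReal_neg_one _ _

/-- **`Aut(A(τ), ι)` acts on `T_{A(τ)}` through the sign character**: every unit `u` of `End(A(τ), ι)` acts on the
transcendental lattice by `+1` (`ρ_r(u) = ±1`) or by `−1` (`ρ_r(u) = ±J_τ`, the order-`4` automorphisms of the
`Z(1)`-members). [cite: ShiodaMitani1974, §1 (1.5)–(1.6)] [cite: KudlaRapoportYang2006, §3.2 Prop. 3.2.1 (proof) p. 48 and §3.4 (3.4.7)] [cite: Lange2023AbelianVarietiesComplex, §7.2.2 Thm. 7.2.4 (proof, Step I)] -/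
theorem compContinuousLinearMap_analyticRepReal_transcendental_of_isUnit {M : equivariantEndRingInt ha hb hτ}
    (hM : IsUnit M) {t : (Fin 2 → ℂ) [⋀^Fin 2]→L[ℝ] ℂ} (ht : t ∈ transcendentalLattice (period a b ha hb hτ)) :
    (((M : Matrix (Fin 4) (Fin 4) ℤ).map (Int.cast : ℤ → ℝ) = 1 ∨
        (M : Matrix (Fin 4) (Fin 4) ℤ).map (Int.cast : ℤ → ℝ) = -1) ∧
      t.compContinuousLinearMap (analyticRepReal (period a b ha hb hτ) (period a b ha hb hτ)
        ((M : Matrix (Fin 4) (Fin 4) ℤ).map (Int.cast : ℤ → ℝ))) = t) ∨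
    (((M : Matrix (Fin 4) (Fin 4) ℤ).map (Int.cast : ℤ → ℝ) = jMatrix (period a b ha hb hτ) ∨
        (M : Matrix (Fin 4) (Fin 4) ℤ).map (Int.cast : ℤ → ℝ) = -jMatrix (period a b ha hb hτ)) ∧
      t.compContinuousLinearMap (analyticRepReal (period a b ha hb hτ) (period a b ha hb hτ)
        ((M : Matrix (Fin 4) (Fin 4) ℤ).map (Int.cast : ℤ → ℝ))) = -t) := by
  rcases map_coe_eq_or_of_isUnit ha hb hτ hM with h | h | h | h
  · exact Or.inl ⟨Or.inl h, compContinuousLinearMap_analyticRepReal_eq_self_of_mem_transcendentalLattice ha hb hτ (Or.inl h) ht⟩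
  · exact Or.inl ⟨Or.inr h, compContinuousLinearMap_analyticRepReal_eq_self_of_mem_transcendentalLattice ha hb hτ (Or.inr h) ht⟩
  · exact Or.inr ⟨Or.inl h, compContinuousLinearMap_analyticRepReal_eq_neg_of_mem_transcendentalLattice ha hb hτ (Or.inl h) ht⟩
  · exact Or.inr ⟨Or.inr h, compContinuousLinearMap_analyticRepReal_eq_neg_of_mem_transcendentalLattice ha hb hτ (Or.inr h) ht⟩

/-- **At a `Z(1)`-point some automorphism of `(A(τ), ι)` negates `T_{A(τ)}`** (and fixes `NS(A(τ))`).
[cite: KudlaRapoportYang2006, §3.4 Def. 3.4.2, (3.4.6)–(3.4.7)] [cite: ShiodaMitani1974, §1] -/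
theorem exists_forall_transcendental_eq_neg_of_natCard_eq_four (h4 : Nat.card (equivariantEndRingInt ha hb hτ)ˣ = 4) :
    ∃ M ∈ equivariantEndRingInt ha hb hτ,
      (∀ t ∈ transcendentalLattice (period a b ha hb hτ),
        t.compContinuousLinearMap (analyticRepReal (period a b ha hb hτ) (period a b ha hb hτ)
          (M.map (Int.cast : ℤ → ℝ))) = -t) ∧
      ∀ η ∈ neronSeveriGroup (period a b ha hb hτ),
        η.compContinuousLinearMap (analyticRepReal (period a b ha hb hτ) (period a b ha hb hτ)
          (M.map (Int.cast : ℤ → ℝ))) = η := by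
  obtain ⟨M, hM, hJ⟩ := (natCard_units_eq_four_iff_exists_map_coe_eq_jMatrix ha hb hτ).1 h4
  have hu : IsUnit (⟨M, hM⟩ : equivariantEndRingInt ha hb hτ) :=
    (isUnit_iff_map_coe_eq_or ha hb hτ ⟨M, hM⟩).2 (Or.inr (Or.inr (Or.inl hJ)))
  exact ⟨M, hM, fun t ht ↦ compContinuousLinearMap_analyticRepReal_eq_neg_of_mem_transcendentalLattice ha hb hτ (Or.inl hJ) ht,
    fun η hη ↦ compContinuousLinearMap_analyticRepReal_eq_self_of_mem_neronSeveriGroup ha hb hτ hu hη⟩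

end Family

/-! ## §3 Validation: `(a, b) = (−1, 3)`, `τ = i` -/

section Validation

/-- **`R_i` acts on `T_{A(i)}` by `−1`** (`(−1,3)` family; `ρ_r(R_i) = J_i`, g27-#5 `map_rmulInt_I_eq_jMatrix_neg_one_three_I`).
[cite: ShiodaMitani1974, §1 (1.6)] [cite: KudlaRapoportYang2006, §3.4 (3.4.6)–(3.4.7)] -/
theorem compContinuousLinearMap_analyticRepReal_rmulInt_I_of_mem_transcendentalLattice
    {t : (Fin 2 → ℂ) [⋀^Fin 2]→L[ℝ] ℂ}
    (ht : t ∈ transcendentalLattice (period (-1) 3 (by norm_num) (by norm_num) im_I_ne_zero')) :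
    t.compContinuousLinearMap (analyticRepReal (period (-1) 3 (by norm_num) (by norm_num) im_I_ne_zero')
      (period (-1) 3 (by norm_num) (by norm_num) im_I_ne_zero') ((rmulInt (-1) 3 ![0, 1, 0, 0]).map (Int.cast : ℤ → ℝ))) = -t :=
  compContinuousLinearMap_analyticRepReal_eq_neg_of_mem_transcendentalLattice (a := -1) (b := 3) (by norm_num) (by norm_num)
    im_I_ne_zero' (Or.inl map_rmulInt_I_eq_jMatrix_neg_one_three_I) ht

end Validation

end QuaternionType

end Literature.Geometry.Kaehler.ComplexTorus
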